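import Mathlib

/-!
# SoloBlind — the texture inequality holds for all mean-field (product) states, at every |μ| ≤ d

Solo programme `solo-AtomisticToContinuum-blind`, session 5, §12.7.6′ (Proposition 12.9) of the solo paper.

Informal setting (NOT formalised): hard-core bosons = spin ½ XY model, `H_μ = -∑_b (S¹_x S¹_y + S²_x S²_y) - μ ∑_x S³_x`
on a `D`-regular graph (`D = 2d` on `ℤᵈ`).  A product state `ψ = ⊗_x ψ_x` is described by Bloch vectors
`(m¹_x, m²_x, z_x)` with `(m¹_x)² + (m²_x)² + z_x² ≤ 1/4`, and `⟨H_μ⟩_ψ = -∑_b (m¹_x m¹_y + m²_x m²_y) - μ ∑_x z_x`.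
Distributing the field term over bonds (`∑_x z_x = D⁻¹ ∑_b (z_x + z_y)` on a `D`-regular graph), the per-bond inequality
below sums to
`⟨H_μ⟩_ψ + |B| (1/4 + μ²/D²) ≥ ½ ∑_b |m^⊥_x - m^⊥_y|²`,
and `-|B|(1/4 + μ²/D²)` is the energy of the uniform canted product state (`z ≡ μ/D`), hence `≥ E₀(μ)` for `|μ| ≤ D/2`.
So the zero-temperature Gaussian-domination / texture inequality (TEX_μ) of `SoloBlindTextureDuality`
(`⟨H_μ⟩_ψ - E₀(μ) ≥ ½ ‖∇⟨S¹⟩_ψ‖²`, even with both in-plane components) holds for every mean-field texture at every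
physical chemical potential, with no reflection positivity: the `μ S³` term, which destroys reflection positivity,
is harmless at the mean-field level (it is absorbed by completing a square in `z`).  The content of (TEX_μ) is
therefore entirely in entangled states.  Pure real algebra below; the bookkeeping identification is the docstring's.
-/

namespace Summit.AtomisticToContinuum.BoseEinsteinCondensation.Theorems

/-- Per-bond mean-field texture inequality: for Bloch vectors in the ball of radius `1/2`,
`½ |m^⊥_x - m^⊥_y|² ≤ -(m^⊥_x · m^⊥_y) - (μ/D)(z_x + z_y) + 1/4 + μ²/D²`
(the deficit is `½ (z_x - μ/D)² + ½ (z_y - μ/D)²` plus the slack of the ball constraints). -/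
theorem bond_meanField_texture_le (a₁ a₂ zx b₁ b₂ zy μ D : ℝ) (hD : D ≠ 0)
    (hx : a₁ ^ 2 + a₂ ^ 2 + zx ^ 2 ≤ 1 / 4) (hy : b₁ ^ 2 + b₂ ^ 2 + zy ^ 2 ≤ 1 / 4) :
    ((a₁ - b₁) ^ 2 + (a₂ - b₂) ^ 2) / 2
      ≤ -(a₁ * b₁ + a₂ * b₂) - μ / D * (zx + zy) + (1 / 4 + μ ^ 2 / D ^ 2) := by
  have h1 : 0 ≤ (zx - μ / D) ^ 2 := sq_nonneg _
  have h2 : 0 ≤ (zy - μ / D) ^ 2 := sq_nonneg _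
  have key : -(a₁ * b₁ + a₂ * b₂) - μ / D * (zx + zy) + (1 / 4 + μ ^ 2 / D ^ 2)
      - ((a₁ - b₁) ^ 2 + (a₂ - b₂) ^ 2) / 2
      = (1 / 4 - (a₁ ^ 2 + a₂ ^ 2 + zx ^ 2)) / 2 + (1 / 4 - (b₁ ^ 2 + b₂ ^ 2 + zy ^ 2)) / 2
        + (zx - μ / D) ^ 2 / 2 + (zy - μ / D) ^ 2 / 2 := by
    field_simp
    ring
  nlinarith [key, h1, h2, hx, hy]

/-- The uniform canted product state saturates the per-bond bound: with `z = μ/D` and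
`|m^⊥|² = 1/4 - z²` on both ends (equal in-plane vectors), the bond energy is exactly `-(1/4 + μ²/D²)`.
(This is why `-|B|(1/4 + μ²/D²) ≥ E₀(μ)` for `|μ| ≤ D/2`: it is the energy of an admissible trial state.) -/
theorem bond_meanField_uniform_eq (a₁ a₂ μ D : ℝ) (hD : D ≠ 0)
    (h : a₁ ^ 2 + a₂ ^ 2 + (μ / D) ^ 2 = 1 / 4) :
    -(a₁ * a₁ + a₂ * a₂) - μ / D * (μ / D + μ / D) = -(1 / 4 + μ ^ 2 / D ^ 2) := by
  have : a₁ * a₁ + a₂ * a₂ = 1 / 4 - (μ / D) ^ 2 := by nlinarith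
  rw [this]
  field_simp
  ring

/-- Summed form over any finite set of bonds `B` with endpoint maps `src, tgt` and Bloch components
`m₁ m₂ z` in the ball of radius `1/2`:
`∑_b ½|m^⊥_{src b} - m^⊥_{tgt b}|² ≤ ∑_b [-(m^⊥·m^⊥) - (μ/D)(z_src + z_tgt)] + |B| (1/4 + μ²/D²)`.
On a `D`-regular graph the first sum on the right is `⟨H_μ⟩_ψ` of the product state. -/
theorem meanField_texture_le {ι β : Type*} (B : Finset β) (src tgt : β → ι)
    (m₁ m₂ z : ι → ℝ) (μ D : ℝ) (hD : D ≠ 0)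
    (hball : ∀ x, m₁ x ^ 2 + m₂ x ^ 2 + z x ^ 2 ≤ 1 / 4) :
    ∑ b ∈ B, ((m₁ (src b) - m₁ (tgt b)) ^ 2 + (m₂ (src b) - m₂ (tgt b)) ^ 2) / 2
      ≤ ∑ b ∈ B, (-(m₁ (src b) * m₁ (tgt b) + m₂ (src b) * m₂ (tgt b))
            - μ / D * (z (src b) + z (tgt b)))
        + (B.card : ℝ) * (1 / 4 + μ ^ 2 / D ^ 2) := by
  have hsum : ∑ b ∈ B, ((m₁ (src b) - m₁ (tgt b)) ^ 2 + (m₂ (src b) - m₂ (tgt b)) ^ 2) / 2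
      ≤ ∑ b ∈ B, ((-(m₁ (src b) * m₁ (tgt b) + m₂ (src b) * m₂ (tgt b))
            - μ / D * (z (src b) + z (tgt b))) + (1 / 4 + μ ^ 2 / D ^ 2)) := by
    apply Finset.sum_le_sum
    intro b _
    exact bond_meanField_texture_le _ _ _ _ _ _ μ D hD (hball (src b)) (hball (tgt b))
  rw [Finset.sum_add_distrib, Finset.sum_const, nsmul_eq_mul] at hsum
  linarith

end Summit.AtomisticToContinuum.BoseEinsteinCondensation.Theorems
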